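import Mathlib.Algebra.CharP.Lemmas
import Mathlib.RingTheory.PowerSeries.Order
import Summits.BirchSwinnertonDyer.BirchSwinnertonDyer.Theorems.ResidualThetaTransportAtTwoLambdaLowerBoundOWeierstrass
import HarnessLib

/-!
# `λ` of the local Euler-factor module `Λ_𝒪/((1+T)^{pᵏ} − u)`: `pᵏ` if `u ≡ 1 (mod 𝔪)`, else `0` —
# the Greenberg–Vatsal local term `s_ℓ · d_ℓ` of the crux's `Σ_g(S₀)` ((f5) of LINE-DESIGN-g11)

Route `ResidualThetaTransportAtTwo` (RTT), crux (R≥)ᵖ `ResidualThetaCountLowerPureAtTwo`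
(stmt-BirchSwinnertonDyer-26074); seat `prover-bsd-wall-rtt-p2` g11 (`--supports`, closes nothing).
HONEST FRAMING: THEOREMS ONLY (no definition, no named fact, no instance, no `sorry`); pure commutative
algebra; nothing about any Selmer group or Euler factor is asserted; BSD is not proved by any of this.

WHY (memo `Cruxes/ResidualThetaCountLowerPureAtTwo/LINE-DESIGN-g11.md` §2 (f5); THETA-LINE-ideator2-r1g5 §1
step 5 (ii)). The crux's CM-side sum `Σ_g(S₀) = ∑_{v∈S₀} 2^{v₂((ℓ_v²−1)/8)} · d_{g,ℓ_v}` is the λ-invariant of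
the `S₀`-imprimitivity correction: at a prime `ℓ ≠ p` with `s_ℓ = p^k` primes of `ℚ_∞` above it, each root
`α` of the local Euler polynomial contributes the cyclic `Λ_𝒪`-module `Λ_𝒪/((1+T)^{p^k} − α')` (after the
harmless substitution `1+T ↦ (1+T)^{unit}`), whose λ-invariant is `p^k` if `α' ≡ 1 (mod 𝔪)` and `0`
otherwise (Greenberg–Vatsal 2000, §2, proof of Prop. 2.4: «the λ-invariant of `𝓟_ℓ` is `s_ℓ d_ℓ`»). This file
proves exactly that computation in the λ-currency of the companion files:

* `map_onePlusX_pow_sub_C` — over a residue field of characteristic `p`: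
  `((1+T)^{p^k} − C u) mod 𝔪 = C(1 − ū) + T^{p^k}` (freshman's dream);
* **`order_map_onePlusX_pow_sub_C_of_eq_one`** / **`…_of_ne_one`** — its `T`-order is `p^k` if `ū = 1`,
  `0` if `ū ≠ 1`;
* **`free_finrank_quotient_span_onePlusX_pow_sub_C_of_eq_one`** / **`…_of_ne_one`** — over `𝒪 = 𝒪_E`
  (`E/ℚ_p` finite): `𝒪⟦T⟧/((1+T)^{p^k} − C u)` is free over `𝒪` of rank `p^k` if `u ≡ 1 (mod 𝔪)`, of rank `0` otherwise
  (`LambdaLowerBoundO.free_finrank_quotient_span_of_order_eq`, Weierstrass preparation).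

References: [GreenbergVatsal2000] §2 (Prop. 2.4 and the computation of `λ(𝓟_ℓ) = s_ℓ d_ℓ`);
[Washington1997] §7.1 Thm. 7.3.
-/

set_option autoImplicit false
-- the Theorems namespace of this sub repeats the summit name by design (D-0017 nested layout)
set_option linter.dupNamespace false

noncomputable section

open PowerSeries

namespace Summit.BirchSwinnertonDyer.BirchSwinnertonDyer.Theorems.LambdaLowerBoundO

universe u

section Residual

variable {O : Type u} [CommRing O] [IsLocalRing O] (p : ℕ) [Fact p.Prime]
  [CharP (IsLocalRing.ResidueField O) p]

/-- **Freshman's dream on the Euler-factor series**: modulo `𝔪`,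
`(1+T)^{p^k} − C u ↦ C(1 − ū) + T^{p^k}`. [folklore] -/
theorem map_onePlusX_pow_sub_C (k : ℕ) (u : O) :
    (((1 : PowerSeries O) + X) ^ (p ^ k) - C u).map (IsLocalRing.residue O) =
      C (1 - IsLocalRing.residue O u) + (X : PowerSeries (IsLocalRing.ResidueField O)) ^ (p ^ k) := by
  haveI : CharP (PowerSeries (IsLocalRing.ResidueField O)) p :=
    charP_of_injective_algebraMap (algebraMap (IsLocalRing.ResidueField O) _).injective p
  rw [map_sub, map_pow, map_add, map_one, map_X, map_C, add_pow_char_pow, one_pow, map_sub, map_one]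
  ring

/-- **`ord_T(((1+T)^{p^k} − u) mod 𝔪) = p^k` when `u ≡ 1 (mod 𝔪)`.** [cite: GreenbergVatsal2000, §2 Prop. 2.4] -/
theorem order_map_onePlusX_pow_sub_C_of_eq_one (k : ℕ) {u : O} (hu : IsLocalRing.residue O u = 1) :
    ((((1 : PowerSeries O) + X) ^ (p ^ k) - C u).map (IsLocalRing.residue O)).order =
      ((p ^ k : ℕ) : ℕ∞) := by
  rw [map_onePlusX_pow_sub_C p, hu, sub_self, map_zero, zero_add, order_X_pow]

/-- **`ord_T(((1+T)^{p^k} − u) mod 𝔪) = 0` when `u ≢ 1 (mod 𝔪)`** (the constant term `1 − ū ≠ 0`).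
[cite: GreenbergVatsal2000, §2 Prop. 2.4] -/
theorem order_map_onePlusX_pow_sub_C_of_ne_one (k : ℕ) {u : O} (hu : IsLocalRing.residue O u ≠ 1) :
    ((((1 : PowerSeries O) + X) ^ (p ^ k) - C u).map (IsLocalRing.residue O)).order =
      ((0 : ℕ) : ℕ∞) := by
  rw [map_onePlusX_pow_sub_C p, order_eq_nat]
  refine ⟨?_, fun i hi => absurd hi (Nat.not_lt_zero i)⟩
  have hpk : p ^ k ≠ 0 := pow_ne_zero _ (Fact.out : p.Prime).ne_zero
  rw [map_add, coeff_C, coeff_X_pow, if_pos rfl, if_neg (Ne.symm hpk), add_zero]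
  exact sub_ne_zero.2 (Ne.symm hu)

end Residual

/-! ### Over `𝒪 = 𝒪_E` -/

section UnitBall

open Literature.NumberTheory.Automorphic

variable (p : ℕ) [Fact p.Prime] (E : IntermediateField ℚ_[p] (PadicAlgCl p)) [FiniteDimensional ℚ_[p] E]

omit [FiniteDimensional ℚ_[p] E] in
/-- The residue field of `𝒪_E` has characteristic `p` (`p ∈ 𝔪`). [folklore] -/
theorem charP_residueField_unitBall :
    CharP (IsLocalRing.ResidueField (PadicIntermediateField.unitBall p E)) p := by
  rw [CharP.charP_iff_prime_eq_zero (Fact.out : p.Prime)]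
  have h := PadicIntermediateField.natCast_prime_mem_maximalIdeal p E
  rw [← IsLocalRing.residue_eq_zero_iff] at h
  rw [← map_natCast (IsLocalRing.residue (PadicIntermediateField.unitBall p E)) p]
  exact h

/-- **`λ(Λ_𝒪/((1+T)^{p^k} − u)) = p^k` when `u ≡ 1 (mod 𝔪)`**: over `𝒪 = 𝒪_E`, the quotient
`𝒪⟦T⟧/((1+T)^{p^k} − C u)` is free over `𝒪` of rank `p^k` — the Greenberg–Vatsal local λ-term `s_ℓ d_ℓ`
per Frobenius root (`s_ℓ = p^k` primes of `ℚ_∞` over `ℓ`; the root counts when `ℓ⁻¹α ≡ 1 (mod 𝔪)`).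
[cite: GreenbergVatsal2000, §2 Prop. 2.4] -/
theorem free_finrank_quotient_span_onePlusX_pow_sub_C_of_eq_one (k : ℕ)
    {u : PadicIntermediateField.unitBall p E}
    (hu : IsLocalRing.residue (PadicIntermediateField.unitBall p E) u = 1) :
    Module.Free (PadicIntermediateField.unitBall p E)
        (PowerSeries (PadicIntermediateField.unitBall p E) ⧸
          Ideal.span {((1 : PowerSeries (PadicIntermediateField.unitBall p E)) + X) ^ (p ^ k) - C u}) ∧
      Module.Finite (PadicIntermediateField.unitBall p E)
        (PowerSeries (PadicIntermediateField.unitBall p E) ⧸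
          Ideal.span {((1 : PowerSeries (PadicIntermediateField.unitBall p E)) + X) ^ (p ^ k) - C u}) ∧
      Module.finrank (PadicIntermediateField.unitBall p E)
        (PowerSeries (PadicIntermediateField.unitBall p E) ⧸
          Ideal.span {((1 : PowerSeries (PadicIntermediateField.unitBall p E)) + X) ^ (p ^ k) - C u}) =
        p ^ k := by
  haveI := charP_residueField_unitBall p E
  exact free_finrank_quotient_span_of_order_eq p E _ (p ^ k)
    (order_map_onePlusX_pow_sub_C_of_eq_one p k hu)

/-- **`λ(Λ_𝒪/((1+T)^{p^k} − u)) = 0` when `u ≢ 1 (mod 𝔪)`**: the series is a unit and the quotient is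
trivial (free of rank `0`) — the root does not count. [cite: GreenbergVatsal2000, §2 Prop. 2.4] -/
theorem free_finrank_quotient_span_onePlusX_pow_sub_C_of_ne_one (k : ℕ)
    {u : PadicIntermediateField.unitBall p E}
    (hu : IsLocalRing.residue (PadicIntermediateField.unitBall p E) u ≠ 1) :
    Module.Free (PadicIntermediateField.unitBall p E)
        (PowerSeries (PadicIntermediateField.unitBall p E) ⧸
          Ideal.span {((1 : PowerSeries (PadicIntermediateField.unitBall p E)) + X) ^ (p ^ k) - C u}) ∧
      Module.Finite (PadicIntermediateField.unitBall p E)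
        (PowerSeries (PadicIntermediateField.unitBall p E) ⧸
          Ideal.span {((1 : PowerSeries (PadicIntermediateField.unitBall p E)) + X) ^ (p ^ k) - C u}) ∧
      Module.finrank (PadicIntermediateField.unitBall p E)
        (PowerSeries (PadicIntermediateField.unitBall p E) ⧸
          Ideal.span {((1 : PowerSeries (PadicIntermediateField.unitBall p E)) + X) ^ (p ^ k) - C u}) =
        0 := by
  haveI := charP_residueField_unitBall p E
  exact free_finrank_quotient_span_of_order_eq p E _ 0
    (order_map_onePlusX_pow_sub_C_of_ne_one p k hu)

end UnitBall

end Summit.BirchSwinnertonDyer.BirchSwinnertonDyer.Theorems.LambdaLowerBoundO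

end
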